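import Summits.BirchSwinnertonDyer.BirchSwinnertonDyer.Theorems.SylvesterTwoHeegnerIndexCMDataCoupledFrame
import Summits.BirchSwinnertonDyer.BirchSwinnertonDyer.Theorems.SylvesterTwoHeegnerIndexCMDataClassInvariance
import Summits.BirchSwinnertonDyer.BirchSwinnertonDyer.Theorems.SylvesterTwoHeegnerIndexCMDataPairRecipe
import Literature.NumberTheory.EllipticCurves.HuShuYin2019.SylvesterPairGoodPlaces
import HarnessLib

/-!
# (F) of leaf (L1), crux `UpperOffV0HSYPlus` (stmt-BirchSwinnertonDyer-19804): the BOTTOM point `P₁ = κ⁻¹ ι(y₁)`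
# of the HSY tower at level `9pℓ` and its `χ_B`-class at `λ` — #14's binders `hFP₂` / `hsel₂`

Skeleton of record VARIANT M (`Cruxes/UpperOffV0HSYPlus/Lines/coupled_variantM.lean` 406ca288e244d392);
card v28; planner D475 (GO on the rows' (F) assembly).  Sibling of `…CMFlipLevelPrimePrep` /
`…CMFlipLevelPrime` (k-ty1 #14 instantiated at the single-prime level):

* `smul_symm_bottom_eq_self` — HSY's bottom point `y₁` read in `W₀(K[9pℓ])` comes from `W₀(K[9p])`
  (#R-a `exists_map_eq_phi_sylvesterTau_one_of_sq_add_self_add_one` + `map_injective_ringClassField` + x11b3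
  `RingClassTower.map_toRatAlgHom_map_inclusion`), so `κ⁻¹ ι(y₁) ∈ E₉(K̄)` is fixed by the `K[9p]`-fixer `N'`
  (behind #14's `hFP₂`: an arithmetic Frobenius above `λ` lies in `N'`, #17b §4);
* `kolyvaginClass_bottom_mem_selmerLocalKer` — the class of `ψ_B(P^{χ_B})` for an `N'`-fixed `P`, built with
  `A₂ = ψ_B(E₉(K̄)^N)` as #14 reads it, is Selmer at every finite `v ∤ 3p`: Gross 6.2 (1) at the UNRAMIFIED level
  `9p` (k-ty1 #11 `kolyvaginClass_cmFrame_cubeSumCurve_prime_mem_selmerLocalKer` with `N'` = the fixer of the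
  embedded `K[9p]`, normal, `A' = ψ_B(E₉(K̄)^{N'})` admissible by #R-c's `h6`), moved to `A₂ ⊇ A'` by #R-h
  `kolyvaginClass_mono` — #14's `hsel₂` at the bottom.

HONEST FRAMING: theorems only (no definition, no named fact, no instance, no notation); assembly of PROVED
tree theorems; nothing about Sel/Ш beyond the stated local condition, nothing about the FLIP iff or BSD; no
stub closed; `--supports stmt-BirchSwinnertonDyer-19804 --as helper`.

## References
* B. H. Gross, LMS LNS 153 (1991), §3 (p. 238), §4 (4.1)–(4.6), Prop. 6.2 (1). [GrossLMS1991]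
* W. G. McCallum, LMS LNS 153 (1991), §4 Lemma 4.1, (6). [McCallumLMS1991]
* Y. Hu, J. Shu, H. Yin, Trans. AMS 372 (2019), arXiv 1708.05266, §2 Prop. 2.4, §4.1. [HuShuYin2019]
* D. A. Cox, *Primes of the form x² + ny²*, 2nd ed., §9.A. [Cox2013]

## Mathlib / tree search
Tree: `exists_map_eq_phi_sylvesterTau_one_of_sq_add_self_add_one`, `map_injective_ringClassField` (#R-a),
`ringClassField_nine_mul_le`, `pow_three_ne_six_of_fix_sylvester_prime`, `le_of_mem_iff_of_mem_iff_forall` (#R-c),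
`RingClassTower.map_toRatAlgHom_map_inclusion` (x11b3), `smul_embPoints_eq_of_comp`, `normal_of_mem_iff`
(`GeomPointsEmbeddingDescent`), `HuShuYin2019.isAdmissible_map_fixedPoints_cubeSumCurve_nine`,
`JZero.cubicTwist_chiComponent_fixedPoints_mem_invPoints`, `KolyvaginCocycle.chiComponent_mem`,
`kolyvaginClass_cmFrame_cubeSumCurve_prime_mem_selmerLocalKer` (#11), `SylvesterTwoCMData.kolyvaginClass_mono` (#R-h).
`lean search 'bottom_mem_selmerLocalKer|smul_symm_bottom'` → nothing before this file.  presearch: n/a (assembly).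
-/

set_option linter.dupNamespace false -- Summits modules are `Summit.<Summit>.<Problem>…` by design
set_option autoImplicit false

noncomputable section

open scoped Classical Pointwise

namespace Summit.BirchSwinnertonDyer.BirchSwinnertonDyer.Theorems.SylvesterTwoCMFlip

open WeierstrassCurve Field NumberField IsDedekindDomain Finset
open Literature.NumberTheory.EllipticCurves Literature.NumberTheory.GaloisRepresentations
  Literature.NumberTheory.EllipticCurves.ModularForms
  Literature.NumberTheory.EllipticCurves.HuShuYin2019
  Literature.NumberTheory.EllipticCurves.KolyvaginCocycle
  Summit.BirchSwinnertonDyer.BirchSwinnertonDyer.Theorems.SylvesterTwoCMData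
  Summit.BirchSwinnertonDyer.Rank1Residual.X11b
  Summit.BirchSwinnertonDyer.Rank1Residual.X11b.RingClassTower

variable {K : Type} [Field K] [NumberField K]

/-! ### The bottom point `P₁ = κ⁻¹ ι(y₁)` is fixed by the `K[9p]`-fixer `N'` -/

/-- **HSY's bottom CM point, read at level `9pℓ`, is fixed by `N'`**: the point `y₀ ∈ W₀(K[9pℓ])` over
`heegnerTau(A, B, C)` is the push-forward of #R-a's `y₁ ∈ W₀(K[9p])` (injectivity of `W₀(K[9pℓ]) → W₀(ℂ)`),
so every `h ∈ Γ_K` fixing `emb x` for the `x ∈ K[9pℓ]` lying in `K[9p]` fixes `κ⁻¹ ι(y₀)`.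
[cite: GrossLMS1991, §3 (p. 238: y_m ∈ E(K_m)), §4 (4.2)] [cite: HuShuYin2019, §4.1 (P₁ ∈ X₀(3⁵)(H_{9p}))] -/
theorem smul_symm_bottom_eq_self {ω : K} (hω : ω ^ 2 + ω + 1 = 0) (h2 : Module.finrank ℚ K = 2)
    (ι : K →+* ℂ) (Dt : ModularParametrizationData (⟨0, 0, 1, 0, -1⟩ : WeierstrassCurve ℚ) 243)
    {p ℓ : ℕ} (hp3 : p % 3 = 1) (hℓ0 : ℓ ≠ 0)
    (κ : geomPoints ((cubeSumCurve 9).baseChange K) ≃+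
      geomPoints ((⟨0, 0, 1, 0, -1⟩ : WeierstrassCurve ℚ).baseChange K))
    (hκG : ∀ (g : absoluteGaloisGroup K) (P : geomPoints ((cubeSumCurve 9).baseChange K)),
      κ (g • P) = g • κ P)
    (emb : ringClassField K ι (9 * p * ℓ) →+* AlgebraicClosure K)
    (ιe : letI : DecidableEq (ringClassField K ι (9 * p * ℓ)) := fun a b ↦ Classical.propDecidable (a = b)
      ((⟨0, 0, 1, 0, -1⟩ : WeierstrassCurve ℚ).baseChange (ringClassField K ι (9 * p * ℓ))).toAffine.Point →+
        geomPoints ((⟨0, 0, 1, 0, -1⟩ : WeierstrassCurve ℚ).baseChange K))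
    (hιe : ∀ P, ιe P = Affine.Point.map (W' := (⟨0, 0, 1, 0, -1⟩ : WeierstrassCurve ℚ)) emb.toRatAlgHom P)
    (N' : Subgroup (absoluteGaloisGroup K))
    (hN' : ∀ g : absoluteGaloisGroup K, g ∈ N' ↔
      ∀ x ∈ {x : ringClassField K ι (9 * p * ℓ) | (x : ℂ) ∈ ringClassField K ι (9 * p)},
        (show AlgebraicClosure K ≃ₐ[K] AlgebraicClosure K from g) (emb x) = emb x)
    {y₀ : ((⟨0, 0, 1, 0, -1⟩ : WeierstrassCurve ℚ).baseChange (ringClassField K ι (9 * p * ℓ))).toAffine.Point}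
    (hy₀ : Affine.Point.map (W' := (⟨0, 0, 1, 0, -1⟩ : WeierstrassCurve ℚ))
        (ringClassField K ι (9 * p * ℓ)).subtype.toRatAlgHom y₀ =
      Dt.φ (heegnerTau (81 * ((p : ℤ) ^ 2 + 4 * p + 16), -(9 * (4 * (p : ℤ) ^ 2 + 17 * p + 72)),
        4 * (p : ℤ) ^ 2 + 18 * p + 81))) :
    ∀ h ∈ N', h • κ.symm (ιe y₀) = κ.symm (ιe y₀) := by
  have hK := JZero.isImaginaryQuadratic_of_sq_add_self_add_one hω h2
  have hp0 : p ≠ 0 := by rintro rfl; simp at hp3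
  have hκs : ∀ (g : absoluteGaloisGroup K) (Q : geomPoints ((⟨0, 0, 1, 0, -1⟩ : WeierstrassCurve ℚ).baseChange K)),
      κ.symm (g • Q) = g • κ.symm Q := fun g Q ↦ by
    apply κ.injective
    rw [hκG, κ.apply_symm_apply, κ.apply_symm_apply]
  have hle : ringClassField K ι (9 * p) ≤ ringClassField K ι (9 * p * ℓ) := ringClassField_nine_mul_le hK ι hp0 hℓ0
  obtain ⟨y₁, hy₁⟩ := exists_map_eq_phi_sylvesterTau_one_of_sq_add_self_add_one hω h2 ι Dt hp3
  have hy₀₁ : y₀ = Affine.Point.map (W' := (⟨0, 0, 1, 0, -1⟩ : WeierstrassCurve ℚ))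
      ((RingClassField.inclusion ι hle).restrictScalars ℚ) y₁ := by
    apply map_injective_ringClassField (⟨0, 0, 1, 0, -1⟩ : WeierstrassCurve ℚ) ι (9 * p * ℓ)
    rw [hy₀, map_toRatAlgHom_map_inclusion (W := (⟨0, 0, 1, 0, -1⟩ : WeierstrassCurve ℚ)) ι hle
      (ringClassField K ι (9 * p * ℓ)).subtype (ringClassField K ι (9 * p)).subtype
      (fun x' ↦ RingClassField.coe_inclusion ι hle x') y₁, hy₁]
  intro h hh
  rw [← hκs]
  congr 1
  rw [hιe, hy₀₁, map_toRatAlgHom_map_inclusion (W := (⟨0, 0, 1, 0, -1⟩ : WeierstrassCurve ℚ)) ι hle emb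
    (emb.comp (RingClassField.inclusion ι hle).toRingHom) (fun x' ↦ rfl) y₁]
  letI : DecidableEq (ringClassField K ι (9 * p)) := fun a b ↦ Classical.propDecidable (a = b)
  have key := smul_embPoints_eq_of_comp (⟨0, 0, 1, 0, -1⟩ : WeierstrassCurve ℚ)
    (emb.comp (RingClassField.inclusion ι hle).toRingHom)
    (Affine.Point.map (W' := (⟨0, 0, 1, 0, -1⟩ : WeierstrassCurve ℚ))
      (emb.comp (RingClassField.inclusion ι hle).toRingHom).toRatAlgHom) (fun _ ↦ rfl) h (RingHom.id _)
    (fun z ↦ by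
      change (show AlgebraicClosure K ≃ₐ[K] AlgebraicClosure K from h) (emb (RingClassField.inclusion ι hle z)) =
        emb (RingClassField.inclusion ι hle z)
      exact (hN' h).mp hh _ (by
        rw [Set.mem_setOf_eq, RingClassField.coe_inclusion]; exact z.2)) y₁
  have hid : Affine.Point.map (W' := (⟨0, 0, 1, 0, -1⟩ : WeierstrassCurve ℚ))
      (RingHom.id (ringClassField K ι (9 * p))).toRatAlgHom y₁ = y₁ := by
    rcases y₁ with _ | ⟨x₁, y₁', h₁⟩ <;> rfl
  rw [hid] at key
  exact key

/-! ### The bottom class is Selmer at `λ` (Gross 6.2 (1) at the unramified level `9p`, moved to `A₂`) -/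

/-- **The class of `ψ_B(P^{χ_B})` is Selmer at a finite place `v ∤ 3p` for an `N'`-FIXED point `P ∈ E₉(K̄)`**
(`N'` the `K[9p]`-fixer of an embedded `K[9pℓ]`; the class built with the BIGGER admissible group
`A₂ = ψ_B(E₉(K̄)^N)`, `N = Gal(K̄/emb K[9pℓ])`, as #14 reads it): `N'` is the fixer of the embedded `K[9p]`
(`emb ∘ incl`), hence normal; `A' = ψ_B(E₉(K̄)^{N'})` is admissible at `2` (no `N'`-fixed `∛6`, from #R-c's `h6` for
`N ≤ N'`); `ψ_B(P^{χ_B}) ∈ invPoints A'`; k-ty1 #11 gives the Selmer condition at the good place `v` (unramified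
in `K[9p]`: `v ∤ 9p`) for the class with `A'`, and #R-h `kolyvaginClass_mono` (`A' ≤ A₂`) identifies it with the
class read by #14 — #14's binder `hsel₂` at the bottom. [cite: GrossLMS1991, Prop. 6.2 (1), §4 (4.1)–(4.6)]
[cite: McCallumLMS1991, Lemma 4.1, (6)] [cite: Cox2013, §9.A (K[m]/K unramified outside m)] -/
theorem kolyvaginClass_bottom_mem_selmerLocalKer {ω : K} (hω : ω ^ 2 + ω + 1 = 0) (h2 : Module.finrank ℚ K = 2)
    (ι : K →+* ℂ) {p ℓ : ℕ} (hp : p.Prime) (hp2 : p ≠ 2) (hℓ : ℓ.Prime) (hℓ2 : ℓ ≠ 2)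
    [((cubeSumCurve (p : ℚ)).baseChange K).IsElliptic]
    {vB : AlgebraicClosure K} (hvB : vB ≠ 0)
    (hvB3 : ∀ g : absoluteGaloisGroup K,
      ((show AlgebraicClosure K ≃ₐ[K] AlgebraicClosure K from g) vB) ^ 3 = vB ^ 3)
    {ψB : geomPoints ((cubeSumCurve 9).baseChange K) ≃+ geomPoints ((cubeSumCurve (p : ℚ)).baseChange K)}
    (hψB : ∀ {x y : AlgebraicClosure K}
      (h : (((cubeSumCurve 9).baseChange K).baseChange (AlgebraicClosure K)).toAffine.Nonsingular x y),
      ∃ h', ψB (Affine.Point.some x y h) = Affine.Point.some (vB ^ 2 * x) (vB ^ 3 * y) h')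
    {ρ : absoluteGaloisGroup K →
      geomPoints ((cubeSumCurve 9).baseChange K) ≃+ geomPoints ((cubeSumCurve 9).baseChange K)}
    (hρ : ∀ (g : absoluteGaloisGroup K) {x y : AlgebraicClosure K}
        (h : (((cubeSumCurve 9).baseChange K).baseChange (AlgebraicClosure K)).toAffine.Nonsingular x y),
        ∃ h', ρ g (Affine.Point.some x y h) =
          Affine.Point.some (((show AlgebraicClosure K ≃ₐ[K] AlgebraicClosure K from g) vB / vB) ^ 2 * x)
            y h')
    (hlawB : ∀ (g : absoluteGaloisGroup K) (P : geomPoints ((cubeSumCurve 9).baseChange K)),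
        g • ψB P = ψB (ρ g (g • P)))
    (emb : ringClassField K ι (9 * p * ℓ) →+* AlgebraicClosure K)
    (hemb : ∀ k : K, emb (algebraMap K (ringClassField K ι (9 * p * ℓ)) k) =
      algebraMap K (AlgebraicClosure K) k)
    (N : Subgroup (absoluteGaloisGroup K))
    (hN : ∀ g : absoluteGaloisGroup K, g ∈ N ↔
      ∀ x : ringClassField K ι (9 * p * ℓ),
        (show AlgebraicClosure K ≃ₐ[K] AlgebraicClosure K from g) (emb x) = emb x)
    (N' : Subgroup (absoluteGaloisGroup K))
    (hN' : ∀ g : absoluteGaloisGroup K, g ∈ N' ↔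
      ∀ x ∈ {x : ringClassField K ι (9 * p * ℓ) | (x : ℂ) ∈ ringClassField K ι (9 * p)},
        (show AlgebraicClosure K ≃ₐ[K] AlgebraicClosure K from g) (emb x) = emb x)
    (hN'vB : ∀ h ∈ N', (show AlgebraicClosure K ≃ₐ[K] AlgebraicClosure K from h) vB = vB)
    {ιt : Type} [Fintype ιt] (t : ιt → absoluteGaloisGroup K)
    (ht : Function.Bijective fun i ↦ (t i : absoluteGaloisGroup K ⧸ N'))
    {Pm : geomPoints ((cubeSumCurve 9).baseChange K)} (hPmN' : ∀ h ∈ N', h • Pm = Pm)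
    {hdivB : ∀ P : geomPoints ((cubeSumCurve (p : ℚ)).baseChange K),
      ∃ R : geomPoints ((cubeSumCurve (p : ℚ)).baseChange K), ((2 : ℕ) : ℤ) • R = P}
    (hA₂ : IsAdmissible (absoluteGaloisGroup K)
      ((FixedPoints.addSubgroup N (geomPoints ((cubeSumCurve 9).baseChange K))).map ψB.toAddMonoidHom)
      ((2 : ℕ) : ℤ))
    (hP₂ : ψB (∑ i, ρ (t i) (t i • Pm)) ∈
      invPoints (absoluteGaloisGroup K)
        ((FixedPoints.addSubgroup N (geomPoints ((cubeSumCurve 9).baseChange K))).map ψB.toAddMonoidHom)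
        ((2 : ℕ) : ℤ))
    (v : HeightOneSpectrum (𝓞 K)) (h3v : ((3 : ℕ) : 𝓞 K) ∉ v.asIdeal) (hpv : ((p : ℕ) : 𝓞 K) ∉ v.asIdeal)
    (h9pv : ((9 * p : ℕ) : 𝓞 K) ∉ v.asIdeal) :
    kolyvaginClass ((cubeSumCurve (p : ℚ)).baseChange K) ((2 : ℕ) : ℤ) hdivB hA₂
        (ψB (∑ i, ρ (t i) (t i • Pm))) hP₂ ∈
      selmerLocalKer ((cubeSumCurve (p : ℚ)).baseChange K) (v.adicCompletion K) ((2 : ℕ) : ℤ) := by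
  have hK := JZero.isImaginaryQuadratic_of_sq_add_self_add_one hω h2
  have hdK := JZero.discr_eq_neg_three_of_sq_add_self_add_one hω h2
  have hp0 : p ≠ 0 := hp.ne_zero
  have hf : 9 * p ≠ 0 := mul_ne_zero (by norm_num) hp0
  have hp_odd : Odd p := hp.eq_two_or_odd'.resolve_left hp2
  have hℓ_odd : Odd ℓ := hℓ.eq_two_or_odd'.resolve_left hℓ2
  have hNN' : N ≤ N' := le_of_mem_iff_of_mem_iff_forall emb hN hN'
  have hle : ringClassField K ι (9 * p) ≤ ringClassField K ι (9 * p * ℓ) :=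
    ringClassField_nine_mul_le hK ι hp0 hℓ.ne_zero
  -- the `K[9p]`-fixer as the fixer of an embedded `K[9p]`; its normality; admissibility at level `9p`
  set emb' : ringClassField K ι (9 * p) →+* AlgebraicClosure K :=
    emb.comp (RingClassField.inclusion ι hle).toRingHom with hemb'def
  have hemb' : ∀ k : K, emb' (algebraMap K (ringClassField K ι (9 * p)) k) = algebraMap K (AlgebraicClosure K) k := by
    intro k
    rw [hemb'def, RingHom.comp_apply]
    change emb (RingClassField.inclusion ι hle (algebraMap K _ k)) = _
    rw [AlgHom.commutes, hemb]
  have hN'' : ∀ g : absoluteGaloisGroup K, g ∈ N' ↔ ∀ z : ringClassField K ι (9 * p),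
      (show AlgebraicClosure K ≃ₐ[K] AlgebraicClosure K from g) (emb' z) = emb' z := by
    intro g
    rw [hN' g]
    constructor
    · intro hg z
      exact hg _ (by
        simp only [Set.mem_setOf_eq]
        erw [RingClassField.coe_inclusion]
        exact z.2)
    · intro hg x hx
      have hx' : x = RingClassField.inclusion ι hle ⟨(x : ℂ), hx⟩ :=
        Subtype.ext (by rw [RingClassField.coe_inclusion])
      rw [hx']
      exact hg _
  haveI := (finiteDimensional_and_isGalois_ringClassField hK ι hf).2
  haveI hN'n : N'.Normal := normal_of_mem_iff emb' hemb' N' hN''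
  have h6 := pow_three_ne_six_of_fix_sylvester_prime hK hdK ι hp_odd hℓ_odd emb hemb N hN
  have h6' : ∀ z : AlgebraicClosure K,
      (∀ h ∈ N', (show AlgebraicClosure K ≃ₐ[K] AlgebraicClosure K from h) z = z) → z ^ 3 ≠ 6 :=
    fun z hz ↦ h6 z fun h hh ↦ hz h (hNN' hh)
  have hA' : IsAdmissible (absoluteGaloisGroup K)
      ((FixedPoints.addSubgroup N' (geomPoints ((cubeSumCurve 9).baseChange K))).map ψB.toAddMonoidHom)
      ((2 : ℕ) : ℤ) :=
    isAdmissible_map_fixedPoints_cubeSumCurve_nine K hω hvB hvB3 hρ hlawB N' h6' 1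
  have hPmfix' : Pm ∈ FixedPoints.addSubgroup N' (geomPoints ((cubeSumCurve 9).baseChange K)) :=
    (JZero.mem_fixedPoints_iff _ N' _).mpr hPmN'
  have hQN' : (∑ i, ρ (t i) (t i • Pm)) ∈
      FixedPoints.addSubgroup N' (geomPoints ((cubeSumCurve 9).baseChange K)) :=
    KolyvaginCocycle.chiComponent_mem (fun g ↦ (ρ g).toAddMonoidHom)
      (fun g _ ha ↦ JZero.smul_mem_fixedPoints _ N' g ha)
      (fun g _ ha ↦ JZero.rho_mem_fixedPoints _ hω hvB hvB3 hρ N' g ha) t hPmfix'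
  have hQ' := JZero.cubicTwist_chiComponent_fixedPoints_mem_invPoints hω hvB hvB3 hρ hlawB N' hN'vB t ht
    (m := ((2 : ℕ) : ℤ)) hPmfix' (fun h hh ↦ ⟨0, zero_mem _, by rw [hPmN' h hh, sub_self, smul_zero]⟩)
  have hsel' := kolyvaginClass_cmFrame_cubeSumCurve_prime_mem_selmerLocalKer hK ι hf emb' hemb' N' hN'' hp hp2
    hψB hN'vB (hdiv := hdivB) hA' hQN' hQ' v h3v hpv h9pv
  have hle' : (FixedPoints.addSubgroup N' (geomPoints ((cubeSumCurve 9).baseChange K))).map ψB.toAddMonoidHom ≤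
      (FixedPoints.addSubgroup N (geomPoints ((cubeSumCurve 9).baseChange K))).map ψB.toAddMonoidHom := by
    refine AddSubgroup.map_mono fun z hz ↦ ?_
    rw [JZero.mem_fixedPoints_iff] at hz ⊢
    exact fun g hg ↦ hz g (hNN' hg)
  rw [← kolyvaginClass_mono hA' hA₂ hle' hQ' hP₂]
  exact hsel'

end Summit.BirchSwinnertonDyer.BirchSwinnertonDyer.Theorems.SylvesterTwoCMFlip

end
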